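import Summits.BirchSwinnertonDyer.BirchSwinnertonDyer.Theorems.PrintCf2SplitBadTwoCMShaInvariants
import Literature.NumberTheory.EllipticCurves.ShaRestrictionJZeroDescent
import HarnessLib

/-!
# Crux `PrintCf2.SplitBadTwoRankOneOfFacts` (item stmt-BirchSwinnertonDyer-20368), road α over the CM field:
# `H¹(ℚ, E) ↪ H¹(K, E_K)` and `Ш(E/ℚ) ↪ Ш(E_K/K)` with NO `2`-torsion kernel for `j = −3375` over `K = ℚ(√−7)`,
# hence `(#Ш(E/ℚ)[2^∞])² ∣ #Ш(E_K/K)[2^∞]`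

Cell `bsd-print-cf2`, width seat `bsd-line-cf2-p1-w8` g0 (brick **B6c**, sequel of B6/B6b p649957/p650651/p651330);
`--supports stmt-BirchSwinnertonDyer-20368` (helper). HONEST FRAMING: nothing here closes a crux or a stub; BSD is not proved by any
of this; no summit statement is proved by this seat. No definition is introduced. beyond-print theorem: no.

THE MECHANISM (the `ℤ[(1+√−7)/2]` twin of the tree's `JZero.resBaseChange_injective_of_isPrimitiveRoot`, which does `ℤ[ω]`): the
kernel of `res : H¹(ℚ, E) → H¹(K, E_K)` is `H¹(Gal(K/ℚ), E(K))` (inflation–restriction, the tree's `resKer_le_range_inflClass`); a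
class is given by `P` with `cP = −P`, and it dies iff `P = cQ − Q`. With the complex multiplication `π = [(1+√−7)/2]` — defined over
`K`, conjugated to `π̄ = 1 − π` by `c` — the point `Q := −πP` is such a witness: `cQ − Q = −π̄(cP) + πP = π̄P + πP = (π + π̄)P = P`
because the TRACE of `π` is `1`, ODD (for `ℤ[i]`, all traces are even and the statement fails in general: what matters is that `2` is
UNRAMIFIED in the CM field; here it splits). Everything is kernel-checked from -w2 g7's `π ∈ End_{ℚ̄}(E)` (`exists_cmEndo_of_j_eq_neg3375`),
the dichotomy `σπσ⁻¹ ∈ {π, π̄}` (`conj_cmEndo_eq_or`), `π ∉ End_ℚ(E)` (`cmEndo_not_mem_endRing_rat`) and `K`-rationality of `π` over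
`K ∋ √−7` (`cmEndo_mem_endRing_of_sq_eq_neg_seven`, transported to `E(ℚ̄)` along `algEquivOfEmb K (closureEmb K)`).

* §1 `exists_cmEndo_commute_galRange` — `π₀ ∈ End_{ℚ̄}(E)` with `π₀² = π₀ − 2` commuting with the image `galRange K` of `Γ_K` in `Γ_ℚ`;
  `smul_cmEndo_eq_of_not_mem_endRing` — an element `g₀ ∈ Γ_ℚ` with `Γ_ℚ = galRange K ⊔ galRange K · g₀` ANTI-commutes with `π₀`
  (`g₀ • π₀P = g₀ • P − π₀(g₀ • P)`); `exists_trace_one_coboundary_witness` — the witness `Q = −π₀P`.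
* §2 **`resBaseChange_injective_of_cm`**, **`shaRestriction_injective_of_cm`** — for `W/ℚ` elliptic with `j = −3375` and `K` a quadratic
  number field with `θ² = −7` (`σ₀ ∈ Aut(K/ℚ)`, `σ₀ ≠ 1`): `res : H¹(ℚ, E) → H¹(K, E_K)` and `Ш(E/ℚ) → Ш(E_K/K)` are injective — on ALL of
  `H¹`/`Ш`, not only on `2`-parts; hypothesis-free forms `…_of_isImaginaryQuadratic`.
* §3 **`sq_natCard_sha_two_primary_dvd`** — with B6b (`exists_cm_involution_card_sha_of_isImaginaryQuadratic`: the `c`-fixed part of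
  `Ш(E_K/K)[2^∞]` has the size of `Ш[𝔭^∞]` and `Ш[2^∞]` is its square) and the tree's `conjH1Points_shaRestriction` (`res` lands in
  the fixed part): **`(#Ш(E/ℚ)[2^∞])² ∣ #Ш(E_K/K)[2^∞]`** (`Nat.card`; no finiteness), i.e. `ord₂ #Ш(E/ℚ)[2^∞] ≤ ord₂ #Ш(E_K/K)[𝔭̄^∞]`
  whenever `Ш(E_K/K)[2^∞]` is finite — the UPPER-half direction of the `C₂`-descent of S3c (crux child 27850). NOT here:
  surjectivity of `res` onto the invariants and the local descent `Ш(E/ℚ) = res⁻¹ Ш(E_K/K)` (which would give equality).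

References: J.-P. Serre, *Galois Cohomology*, I.§2.4 (Prop. 9 and Cor.), I.§5.8; B. H. Gross, LMS LNS 153 (1991) §5 (5.1);
[SilvermanATAEC1994] II §2 Thm. 2.2(b); K. Rubin, LNM 1716 (1999) §2.
-/

noncomputable section

open scoped Classical

set_option linter.dupNamespace false
set_option autoImplicit false

namespace Summit.BirchSwinnertonDyer.BirchSwinnertonDyer.Theorems.PrintCf2.CMPrimes

open WeierstrassCurve Literature.NumberTheory.EllipticCurves Field NumberField
open Summit.BirchSwinnertonDyer.BirchSwinnertonDyer.Theorems

/-! ## §1 The CM endomorphism on `E(ℚ̄)`: it commutes with `Γ_K` and anti-commutes with the other coset -/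

section Witness

variable (W : WeierstrassCurve ℚ) [W.IsElliptic] (K : Type) [Field K] [NumberField K]

/-- **`π₀ ∈ End_{ℚ̄}(E)` commutes with `Γ_K ⊆ Γ_ℚ`.** For `W/ℚ` elliptic with `j = −3375` and a number field `K` with `θ² = −7`:
the complex multiplication `π₀` (`π₀² = π₀ − 2`, `#ker π₀ = 2`; -w2 g7's `exists_cmEndo_of_j_eq_neg3375`) satisfies
`n • π₀ P = π₀ (n • P)` for every `n` in the image `galRange K` of `Γ_K → Γ_ℚ`: transport `π₀` to `E_K(K̄)` along
`e = algEquivOfEmb K (closureEmb K)` (algebraic there by `isAlgebraicOn_congr_of_algEquiv`), where it is `K`-rational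
(`cmEndo_mem_endRing_of_sq_eq_neg_seven`), and pull back along `e (resGal σ z) = σ (e z)` (`algEquivOfEmb_resGal_apply`).
[cite: SilvermanATAEC1994, II §2 Thm. 2.2(b) and App. A §3 (row D = -7)] -/
theorem exists_cmEndo_commute_galRange (hj : W.j = -3375) {θ : K} (hθ : θ ^ 2 = -7) :
    ∃ π₀ : AddMonoid.End W.geomPoints, π₀ ∈ W.geomEndRing ∧ π₀ * π₀ = π₀ - 2 ∧
      Nat.card (π₀ : W.geomPoints →+ W.geomPoints).ker = 2 ∧
      ∀ n ∈ galRange (K := ℚ) K, ∀ P : W.geomPoints, n • π₀ P = π₀ (n • P) := by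
  obtain ⟨π₀, hπ₀, hrel₀, hker₀, -⟩ := exists_cmEndo_of_j_eq_neg3375 W hj
  refine ⟨π₀, hπ₀, hrel₀, hker₀, ?_⟩
  -- transport to `E_K(K̄)` along `e`
  haveI : (W.baseChange K).IsElliptic := inferInstanceAs ((W.map (algebraMap ℚ K)).IsElliptic)
  set e := algEquivOfEmb K (closureEmb (K := ℚ) K) with he
  set E := W.geomPointsExtend K e with hE
  -- `π₀ ≠ 0`, hence algebraic
  have hπ₀0 : π₀ ≠ 0 := by
    intro h0
    haveI := charZero_geomEndRing W
    have h2 : ((⟨π₀, hπ₀⟩ : W.geomEndRing) : W.geomEndRing) * ⟨π₀, hπ₀⟩ = ⟨π₀, hπ₀⟩ - 2 :=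
      Subtype.ext (by push_cast; exact hrel₀)
    have : (⟨π₀, hπ₀⟩ : W.geomEndRing) = 0 := Subtype.ext h0
    rw [this, mul_zero, zero_sub, eq_comm, neg_eq_zero] at h2
    exact two_ne_zero h2
  have halg₀ : IsAlgebraicOn W W π₀ := ((mem_geomEndRing_iff_holds W π₀).mp hπ₀).resolve_left hπ₀0
  set π : AddMonoid.End (W.baseChange K).geomPoints :=
    (E.toAddMonoidHom.comp (π₀ : W.geomPoints →+ W.geomPoints)).comp E.symm.toAddMonoidHom with hπ_def
  have hπapp : ∀ Q, π Q = E (π₀ (E.symm Q)) := fun _ ↦ rfl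
  have halg : IsAlgebraicOn (W.baseChange K) (W.baseChange K) π :=
    isAlgebraicOn_congr_of_algEquiv e E (fun _ ↦ rfl) E (fun _ ↦ rfl) halg₀
  have hπmem : π ∈ (W.baseChange K).geomEndRing := Subring.subset_closure halg
  have hπrel : π * π = π - 2 := by
    ext Q
    have e2 : (π - 2 : AddMonoid.End (W.baseChange K).geomPoints) Q = π Q - 2 • Q := by
      change (π : _ →+ _) Q - ((2 : AddMonoid.End (W.baseChange K).geomPoints) : _ →+ _) Q = _
      simp
    refine Eq.trans ?_ e2.symm
    change π (π Q) = _
    rw [hπapp, hπapp, E.symm_apply_apply, cmEndo_apply_apply W hrel₀, map_sub, map_nsmul, E.apply_symm_apply]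
  have hjK : (W.baseChange K).j = -3375 := by simp only [baseChange, map_j, hj]; norm_num
  obtain ⟨-, hπG⟩ := cmEndo_mem_endRing_of_sq_eq_neg_seven (W.baseChange K) hjK hθ hπmem hπrel
  -- compatibility of `E` with `resGal`
  have hEn : ∀ (σ : absoluteGaloisGroup K) (P : W.geomPoints), E (resGal (K := ℚ) K σ • P) = σ • E P := by
    intro σ P
    change (W.baseChange (AlgebraicClosure ℚ)).toAffine.Point at P
    rcases P with _ | ⟨x, y, h⟩
    · rfl
    · exact Affine.Point.some_eq_some_of_eq (algEquivOfEmb_resGal_apply K σ x) (algEquivOfEmb_resGal_apply K σ y)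
  -- conclusion
  intro n hn P
  obtain ⟨σ, rfl⟩ := (mem_galRange_iff K n).mp hn
  apply E.injective
  rw [hEn, ← E.apply_symm_apply (E (π₀ P)), E.symm_apply_apply]
  -- `σ • E (π₀ P) = E (π₀ (resGal σ • P))`
  have h1 : E (π₀ P) = π (E P) := by rw [hπapp, E.symm_apply_apply]
  have h2 : E (π₀ (resGal (K := ℚ) K σ • P)) = π (E (resGal (K := ℚ) K σ • P)) := by rw [hπapp, E.symm_apply_apply]
  rw [h1, ← hπG σ (E P), ← hEn, ← h2]

omit [NumberField K] in
/-- **The other coset anti-commutes.** If `π₀ ∈ End_{ℚ̄}(E)` with `π₀² = π₀ − 2` commutes with a subgroup `N ≤ Γ_ℚ` and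
`Γ_ℚ = N ∪ N·g₀`, then `g₀` conjugates `π₀` to `π̄₀ = 1 − π₀`: `g₀ • π₀ P = g₀ • P − π₀ (g₀ • P)`. Otherwise (dichotomy
`conj_cmEndo_eq_or`) `π₀` would commute with all of `Γ_ℚ`, i.e. lie in `End_ℚ(E) = ℤ` (`cmEndo_not_mem_endRing_rat`).
[cite: SilvermanATAEC1994, II §2 Thm. 2.2(b) with Remark II.2.2.2] -/
theorem smul_cmEndo_eq_of_coset {π₀ : AddMonoid.End W.geomPoints} (hπ₀ : π₀ ∈ W.geomEndRing) (hrel₀ : π₀ * π₀ = π₀ - 2)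
    {N : Subgroup (absoluteGaloisGroup ℚ)} (hN : ∀ n ∈ N, ∀ P : W.geomPoints, n • π₀ P = π₀ (n • P))
    {g₀ : absoluteGaloisGroup ℚ} (hcoset : ∀ g : absoluteGaloisGroup ℚ, g ∈ N ∨ g * g₀⁻¹ ∈ N) (P : W.geomPoints) :
    g₀ • π₀ P = g₀ • P - π₀ (g₀ • P) := by
  rcases conj_cmEndo_eq_or W hπ₀ hrel₀ g₀ with hcomm | hanti
  · -- `g₀` commutes: then `π₀ ∈ End_ℚ(E)`, contradiction
    exfalso
    have hg₀ : ∀ R : W.geomPoints, g₀ • π₀ R = π₀ (g₀ • R) := fun R ↦ by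
      have h := congrArg (fun f : AddMonoid.End W.geomPoints ↦ f (g₀ • R)) hcomm
      simp only [toAddMonoidEnd_mul_mul_toAddMonoidEnd_inv_apply, inv_smul_smul] at h
      exact h
    refine cmEndo_not_mem_endRing_rat W hπ₀ hrel₀
      (Subring.mem_inf.2 ⟨hπ₀, (W.mem_equivariantSubring_iff π₀).2 fun g R ↦ ?_⟩)
    rcases hcoset g with hg | hg
    · exact (hN g hg R).symm
    · obtain ⟨m, hm, rfl⟩ : ∃ m ∈ N, g = m * g₀ := ⟨g * g₀⁻¹, hg, by rw [inv_mul_cancel_right]⟩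
      rw [mul_smul, ← hN m hm, ← hg₀, ← mul_smul]
  · have h := congrArg (fun f : AddMonoid.End W.geomPoints ↦ f (g₀ • P)) hanti
    simp only [toAddMonoidEnd_mul_mul_toAddMonoidEnd_inv_apply, inv_smul_smul] at h
    have e1 : (1 - π₀ : AddMonoid.End W.geomPoints) (g₀ • P) = g₀ • P - π₀ (g₀ • P) := by
      change ((1 : AddMonoid.End W.geomPoints) : _ →+ _) (g₀ • P) - (π₀ : _ →+ _) (g₀ • P) = _
      simp
    rw [e1] at h
    exact h

omit [W.IsElliptic] [NumberField K] in
/-- **The trace-ONE coboundary witness.** If `π₀` commutes with `N` and `g₀` conjugates `π₀` to `1 − π₀`, then for `P` fixed by `N`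
with `g₀ • P = −P` the point `Q := −π₀ P` is fixed by `N` and `g₀ • Q − Q = P` (`−π̄₀(−P) + π₀ P = (π̄₀ + π₀) P = P`).
[folklore] -/
theorem exists_trace_one_coboundary_witness {π₀ : AddMonoid.End W.geomPoints}
    {N : Subgroup (absoluteGaloisGroup ℚ)} (hN : ∀ n ∈ N, ∀ P : W.geomPoints, n • π₀ P = π₀ (n • P))
    {g₀ : absoluteGaloisGroup ℚ} (hg₀ : ∀ P : W.geomPoints, g₀ • π₀ P = g₀ • P - π₀ (g₀ • P))
    (P : W.geomPoints) (hPN : ∀ n ∈ N, n • P = P) (hPflip : g₀ • P = -P) :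
    ∃ Q : W.geomPoints, (∀ n ∈ N, n • Q = Q) ∧ g₀ • Q - Q = P := by
  refine ⟨-π₀ P, fun n hn ↦ by rw [smul_neg, hN n hn, hPN n hn], ?_⟩
  rw [smul_neg, hg₀, hPflip, map_neg]
  abel

end Witness

/-! ## §2 Injectivity of `H¹(ℚ, E) → H¹(K, E_K)` and of `Ш(E/ℚ) → Ш(E_K/K)` -/

section Descent

variable (W : WeierstrassCurve ℚ) [W.IsElliptic] (K : Type) [Field K] [NumberField K]

/-- **EXACT DESCENT of `H¹` along `ℚ(√−7)/ℚ` for `j = −3375`** (no `2`-torsion kernel although `[K:ℚ] = 2`). `E = W/ℚ` elliptic with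
`j = −3375`, `K` a quadratic number field with `θ² = −7` (so `K ≅ ℚ(√−7)`), `σ₀ ∈ Aut(K/ℚ)`, `σ₀ ≠ 1`. Then
`res : H¹(ℚ, E) → H¹(K, E_K)` (`Literature.NumberTheory.EllipticCurves.resBaseChange`) is INJECTIVE: a kernel class is inflated from a
crossed homomorphism `f` on `Γ_ℚ` vanishing on `galRange K` (`resKer_le_range_inflClass`); `P := f g₀` (`g₀ = liftToAbsGal K σ₀`) is
fixed by `galRange K` with `g₀ P = −P`, and `Q := −π₀ P` is a coboundary witness (§1), so `[f] = 0`
(`inflClass_eq_zero_of_index_two_of_witness`). In words: `H¹(Gal(K/ℚ), E(K)) = 0` since `E(K)` is a `ℤ[π]`-module on which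
complex conjugation is semilinear and `π` has odd trace. [cite: SerreGaloisCohomology1997, I.§2.4 (Prop. 9 and Cor.) and I.§5.8]
[cite: SilvermanATAEC1994, II §2 Thm. 2.2(b) and App. A §3 (row D = -7)] -/
theorem resBaseChange_injective_of_cm (hj : W.j = -3375) (h2 : Module.finrank ℚ K = 2) {θ : K} (hθ : θ ^ 2 = -7)
    {σ₀ : K ≃ₐ[ℚ] K} (hσ₀ : σ₀ ≠ 1) : Function.Injective (resBaseChange W K) := by
  haveI : IsGalois ℚ K := by
    haveI : Algebra.IsQuadraticExtension ℚ K := ⟨h2⟩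
    infer_instance
  haveI hNn : (galRange (K := ℚ) K).Normal := normal_galRange K h2 hσ₀
  obtain ⟨π₀, hπ₀, hrel₀, -, hcommN⟩ := exists_cmEndo_commute_galRange W K hj hθ
  rw [injective_iff_map_eq_zero]
  intro c hc
  rw [mem_ker_resBaseChange_iff] at hc
  have hle := resKer_le_range_inflClass (resGal (K := ℚ) K) (pointsMap W K) (pointsMap_smul W K)
    (pointsMapOfEmb_bijective K W _) (galRange (K := ℚ) K) (isOpen_galRange K) le_rfl
  obtain ⟨f, rfl⟩ := hle hc
  obtain ⟨g₀, hg₀⟩ : ∃ g₀ : Field.absoluteGaloisGroup ℚ, liftToAbsGal (K := ℚ) K σ₀ = g₀ := ⟨_, rfl⟩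
  have hg₀N : g₀ ∉ galRange (K := ℚ) K := hg₀ ▸ liftToAbsGal_not_mem K hσ₀
  have hcoset : ∀ g : Field.absoluteGaloisGroup ℚ,
      g ∈ galRange (K := ℚ) K ∨ g * g₀⁻¹ ∈ galRange (K := ℚ) K := fun g ↦ by
    rcases xor_galRange K h2 hσ₀ g with ⟨h1, -⟩ | ⟨h1, -⟩
    · exact Or.inr (hg₀ ▸ h1)
    · exact Or.inl h1
  have hg₀2 : g₀ * g₀ ∈ galRange (K := ℚ) K := by
    rcases xor_galRange K h2 hσ₀ (g₀ * g₀) with ⟨h1, -⟩ | ⟨h1, -⟩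
    · rw [hg₀, mul_inv_cancel_right] at h1
      exact absurd h1 hg₀N
    · exact h1
  -- `P := f g₀` is fixed by `galRange K` and flipped by `g₀`
  have hPflip : g₀ • f.1 g₀ = -f.1 g₀ := by
    have e := cocyclesVanishingOn.cocycle f g₀ g₀
    rw [cocyclesVanishingOn.apply_of_mem f hg₀2] at e
    exact eq_neg_of_add_eq_zero_right e.symm
  have hanti := smul_cmEndo_eq_of_coset W hπ₀ hrel₀ hcommN hcoset
  obtain ⟨Q, hQfix, hQmove⟩ := exists_trace_one_coboundary_witness W hcommN hanti (f.1 g₀)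
    (fun n hn ↦ cocyclesVanishingOn.smul_apply f g₀ hn) hPflip
  exact inflClass_eq_zero_of_index_two_of_witness (galRange (K := ℚ) K) (isOpen_galRange K) f hcoset Q hQfix hQmove

/-- **`Ш(E/ℚ) ↪ Ш(E_K/K)` for `K = ℚ(√−7)` and `j = −3375`**: the restriction `shaRestriction W K` is injective — on all of `Ш`, with no
torsion error. [cite: GrossLMS1991, §5 (5.1)] [cite: SilvermanATAEC1994, II §2 Thm. 2.2(b) and App. A §3 (row D = -7)] -/
theorem shaRestriction_injective_of_cm (hj : W.j = -3375) (h2 : Module.finrank ℚ K = 2) {θ : K} (hθ : θ ^ 2 = -7)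
    {σ₀ : K ≃ₐ[ℚ] K} (hσ₀ : σ₀ ≠ 1) : Function.Injective (shaRestriction W K) := by
  intro c c' h
  apply Subtype.ext
  apply resBaseChange_injective_of_cm W K hj h2 hθ hσ₀
  rw [← coe_shaRestriction_apply, ← coe_shaRestriction_apply, h]

/-- A quadratic number field has a non-trivial automorphism (it is Galois with `#Aut = 2`). [folklore] -/
theorem exists_algEquiv_ne_one_of_finrank_eq_two (h2 : Module.finrank ℚ K = 2) : ∃ σ₀ : K ≃ₐ[ℚ] K, σ₀ ≠ 1 := by
  haveI : IsGalois ℚ K := Literature.FieldTheory.Galois.isGalois_of_finrank_eq_two (F := ℚ) h2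
  have hcard : Nat.card (K ≃ₐ[ℚ] K) = 2 := by rw [IsGalois.card_aut_eq_finrank, h2]
  obtain ⟨x, y, hxy, huniv⟩ := Nat.card_eq_two_iff.mp hcard
  by_cases hx : x = 1
  · exact ⟨y, fun hy ↦ hxy (hx.trans hy.symm)⟩
  · exact ⟨x, hx⟩

/-- **Hypothesis-free form over an imaginary quadratic `K ∋ √−7`**: `res : H¹(ℚ, E) → H¹(K, E_K)` is injective for `j(E) = −3375`.
[cite: SerreGaloisCohomology1997, I.§2.4 (Prop. 9 and Cor.) and I.§5.8] -/
theorem resBaseChange_injective_of_isImaginaryQuadratic (hj : W.j = -3375) (hKq : IsImaginaryQuadratic K) {θ : K}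
    (hθ : θ ^ 2 = -7) : Function.Injective (resBaseChange W K) := by
  obtain ⟨σ₀, hσ₀⟩ := exists_algEquiv_ne_one_of_finrank_eq_two K hKq.1
  exact resBaseChange_injective_of_cm W K hj hKq.1 hθ hσ₀

/-- **Hypothesis-free form**: `Ш(E/ℚ) ↪ Ш(E_K/K)` for `j(E) = −3375` and `K` imaginary quadratic with `θ² = −7`.
[cite: GrossLMS1991, §5 (5.1)] -/
theorem shaRestriction_injective_of_isImaginaryQuadratic (hj : W.j = -3375) (hKq : IsImaginaryQuadratic K) {θ : K}
    (hθ : θ ^ 2 = -7) : Function.Injective (shaRestriction W K) := by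
  obtain ⟨σ₀, hσ₀⟩ := exists_algEquiv_ne_one_of_finrank_eq_two K hKq.1
  exact shaRestriction_injective_of_cm W K hj hKq.1 hθ hσ₀

end Descent

/-! ## §3 `(#Ш(E/ℚ)[2^∞])² ∣ #Ш(E_K/K)[2^∞]` -/

section Count

variable (W : WeierstrassCurve ℚ) [W.IsElliptic] (K : Type) [Field K] [NumberField K]

/-- **`(#Ш(E/ℚ)[2^∞])² ∣ #Ш(E_K/K)[2^∞]`** for `E = W/ℚ` elliptic with `j = −3375` and `K` imaginary quadratic with `θ² = −7`
(`K₀ = ℚ(√−7)`). Proof: for the non-trivial `σ ∈ Aut(K/ℚ)` and its chosen lift `τ`, `res` maps `Ш(E/ℚ)[2^∞]` INJECTIVELY (§2) into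
the `τ_*`-fixed part of `M = Ш(E_K/K)[2^∞]` (`conjH1Points_shaRestriction`), so `#Ш(E/ℚ)[2^∞] ∣ #M^{τ}`
(`AddSubgroup.card_dvd_of_injective`); and `#M = (#M^{τ})²` (B6b `exists_cm_involution_card_sha_of_isImaginaryQuadratic`).
`Nat.card`, no finiteness assumed; for finite `Ш(E_K/K)[2^∞]` this reads `ord₂ #Ш(E/ℚ)[2^∞] ≤ ord₂ #Ш(E_K/K)[𝔭̄^∞]`.
[cite: GrossLMS1991, §5 (5.1)] [cite: SilvermanATAEC1994, II §1 Prop. 1.1, II §2 Thm. 2.2(b), App. A §3 (row D = -7)] -/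
theorem sq_natCard_sha_two_primary_dvd (hj : W.j = -3375) (hKq : IsImaginaryQuadratic K) {θ : K} (hθ : θ ^ 2 = -7) :
    Nat.card (AddCommGroup.primaryComponent W.sha 2) ^ 2 ∣ Nat.card (AddCommGroup.primaryComponent (W.baseChange K).sha 2) := by
  haveI : Fact (Nat.Prime 2) := ⟨Nat.prime_two⟩
  obtain ⟨σ, hσ⟩ := exists_algEquiv_ne_one_of_finrank_eq_two K hKq.1
  have hτ := isLiftOfAut_liftAut σ
  obtain ⟨φ, s, -, -, hs, -, hsq, -⟩ := exists_cm_involution_card_sha_of_isImaginaryQuadratic W hj hKq hθ hσ hτ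
  rw [hsq]
  apply pow_dvd_pow_of_dvd
  -- the injection `Ш(E/ℚ)[2^∞] → ker(s − id)` induced by `res`
  have hinj := shaRestriction_injective_of_isImaginaryQuadratic W K hj hKq hθ
  set M := ↥(AddCommGroup.primaryComponent (W.baseChange K).sha 2) with hM_def
  have hmem : ∀ c : AddCommGroup.primaryComponent W.sha 2,
      shaRestriction W K (c : W.sha) ∈ AddCommGroup.primaryComponent (W.baseChange K).sha 2 := fun c ↦
    map_mem_primaryComponent (shaRestriction W K) c.2
  have hfix : ∀ c : AddCommGroup.primaryComponent W.sha 2,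
      (⟨shaRestriction W K (c : W.sha), hmem c⟩ : M) ∈ (s - AddMonoidHom.id M).ker := fun c ↦ by
    rw [AddMonoidHom.mem_ker, AddMonoidHom.sub_apply, AddMonoidHom.id_apply, sub_eq_zero]
    apply Subtype.ext; apply Subtype.ext
    rw [hs]
    exact conjH1Points_shaRestriction W K hτ (c : W.sha)
  let f : AddCommGroup.primaryComponent W.sha 2 →+ (s - AddMonoidHom.id M).ker :=
    { toFun := fun c ↦ ⟨⟨shaRestriction W K (c : W.sha), hmem c⟩, hfix c⟩
      map_zero' := Subtype.ext (Subtype.ext (by simp))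
      map_add' := fun c c' ↦ Subtype.ext (Subtype.ext (by simp)) }
  refine AddSubgroup.card_dvd_of_injective f fun c c' h ↦ ?_
  have h' : shaRestriction W K (c : W.sha) = shaRestriction W K (c' : W.sha) :=
    congrArg Subtype.val (congrArg Subtype.val h)
  exact Subtype.ext (hinj h')

end Count

end Summit.BirchSwinnertonDyer.BirchSwinnertonDyer.Theorems.PrintCf2.CMPrimes

end
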